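import Mathlib
import HarnessLib
import Literature.MathematicalPhysics.StatisticalMechanics.LinearisedMapLargePartABKM
import Literature.MathematicalPhysics.StatisticalMechanics.RenormalisationMapSummandsSmooth
import Literature.MathematicalPhysics.StatisticalMechanics.TorusPolymerTranslations
import Literature.MathematicalPhysics.StatisticalMechanics.RenormalisationStepTranslation

/-!
# The block part `G(U) = Σ_{B̄ = U} [R_{k+1}K(B) + (B_kK)(B)]` of the linearised map for the torus data:
# `‖G‖_{k+1}^{(A)} ≤ (θ₀ + ε)‖K‖_k^{(A)}` and its Lipschitz (= linear) form ([ABKM19] Lemma 10.1 / 10.2)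

The Lipschitz estimate of `S_k` (CH12-PLAN §5 (e3)) writes
`S(H,K)(U) − S(H',K')(U) = [blockPart D K U − blockPart D K' U] + ΔΣ₁ + ΔΣ₂ᴸ + ΔΣ₃ + ΔΣ₄`
(RenormalisationMapDecompositionABKM).  This file bounds the first piece:

* **`weakNormLE_opC_abkm_conn`** — `LinearisedMapABKMContractionGain.weakNormLE_opC_abkm_gain` (Lemma 10.1,
  `‖C_kK‖_{k+1} ≤ θ₀‖K‖_k`, `θ₀ = L^dA_𝒫·abkmContrConst + ε`) WITHOUT the hypothesis "`R_{k+1}K(X)` is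
  `C^{r₀}` for every `X`" (only connected `X` are read; there it follows from the weak norm);
* `contDiff_largePart_abkm`, **`blockPart_sub_abkm`** (`blockPart D K U − blockPart D K' U = blockPart D (K−K') U`);
* **`tayNormLE_blockPart_abkm`** — for a connected `(k+1)`-polymer `U`:
  `|blockPart D K U|_{T_{k+1}^{U*}, w_{k+1}^U} ≤ C(θ₀ + ε)A^{−|U|_{k+1}}` (`blockPart = opC − largePart`,
  Lemma 10.1 + Lemma 10.2);
* **`tayNormLE_blockPart_sub_abkm`** — the same for `blockPart D K U − blockPart D K' U` with `‖K−K'‖ ≤ C_Δ`.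

Everything is proved; no named fact.

## References
* S. Adams, S. Buchholz, R. Kotecký, S. Müller, arXiv:1910.13564, Lemma 10.1, Lemma 10.2, Ch. 10.1
  [AdamsBuchholzKoteckyMuller2019].
-/

noncomputable section

namespace Literature.MathematicalPhysics.StatisticalMechanics.GradientRG

open scoped BigOperators Classical
open Finset MeasureTheory
open Literature.MathematicalPhysics.StatisticalMechanics.TorusPolymer
  (IsPolymer blocks polys blockOf thicken reblock boxCorner translate IsLatticeVec mem_blocks numBlocks
    isPolymer_blockOf card_blocks_eq_numBlocks isPolymer_translate isConn_translate translate_translate translate_zero)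
open Literature.Barriers.CriticalPhenomena.LongRangePhi4.Polymer (IsConn)
open Literature.MathematicalPhysics.QuantumFieldTheory

variable {d M : ℕ} [NeZero M]

/-- **[ABKM19] Lemma 10.1 for the torus data, closure gain discharged, no global smoothness hypothesis on
`R_{k+1}K`**: the statement of `weakNormLE_opC_abkm_gain` without `hRd` (the linearised map only reads `K`
on connected `k`-polymers, where `R_{k+1}K(X)` is `C^{r₀}` by `contDiff_fluct_of_weakNormLE`).
[cite: AdamsBuchholzKoteckyMuller2019, Lemma 10.1] -/
theorem weakNormLE_opC_abkm_conn {L N Mord R n p r₀ : ℕ} {θbar lam μ δ₁ δ₀ A𝒫 h A : ℝ}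
    {𝒞 : ℕ → (Fin d → ZMod M) → ℝ} (hd : 3 ≤ d) (hLodd : Odd L) (hL : 2 ^ (d + 3) + 16 * R ≤ L)
    (hM : M = L ^ N) {k : ℕ} (hkN : k + 1 ≤ N) (hp : d / 2 + 2 ≤ p) (hpM : p + d ≤ Mord)
    (hMR : Mord ≤ R) (hr₀ : 3 ≤ r₀) (hθbar : 0 < θbar) (hlam : 0 < lam)
    (hB : AbkmWeightBounds L N Mord R n θbar lam μ δ₁ δ₀ A𝒫 𝒞
      (abkmWeightData L N Mord R θbar (schedDelta δ₀ δ₁ N) 𝒞))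
    (hδ₀ : 0 < δ₀) (hδ₁ : 0 < δ₁) (hh : 0 < h) (hh0 : hZeroSq d R δ₀ δ₁ ≤ h ^ 2)
    (hA𝒫 : 0 ≤ A𝒫) (hA : 1 ≤ A) (hA𝒫A : A𝒫 ≤ A)
    (hsmall : (2 : ℝ) ^ (L ^ d) * (A𝒫 * A ^ (-(1 - (1 + 1 / ((2 * (2 ^ d + 1) + 6 : ℝ) ^ d))⁻¹) : ℝ)) ≤ 1)
    (D : StepData d M) (hDs : D.s = L ^ k) (hDL : D.L = L) (hD𝒞 : D.𝒞 = 𝒞 (k + 1))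
    {x₀ : Fin d → ZMod M} (hB₀ : D.B₀ = blockOf (L ^ k) x₀)
    (hc₀ : D.c₀ = boxCorner (L ^ k) (starRad R L d k) x₀)
    {K : Finset (Fin d → ZMod M) → ((Fin d → ZMod M) → ℝ) → ℂ} {C : ℝ} (hC : 0 ≤ C)
    (hK : WeakNormLE (abkmNormParams L N Mord R p r₀ h θbar A (schedDelta δ₀ δ₁ N) 𝒞) k K C)
    (hKt : TransInv (L ^ k) K) (hKd : ∀ X, ContDiff ℝ r₀ (K X))
    (hKloc : ∀ X, IsPolymer (L ^ k) X → IsConn X →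
      IsGaugeLocal ((abkmNormParams L N Mord R p r₀ h θbar A (schedDelta δ₀ δ₁ N) 𝒞).gauge k X) (K X)) :
    WeakNormLE (abkmNormParams L N Mord R p r₀ h θbar A (schedDelta δ₀ δ₁ N) 𝒞) (k + 1) (opC D K)
      (C * ((L : ℝ) ^ d * (A𝒫 * abkmContrConst d L R) +
        largePartEps d L A A𝒫 (1 + 1 / ((2 * (2 ^ d + 1) + 6 : ℝ) ^ d)))) := by
  set P := abkmNormParams L N Mord R p r₀ h θbar A (schedDelta δ₀ δ₁ N) 𝒞 with hP
  have hA0 : 0 < A := by linarith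
  have hk1 : k + 1 ≤ N + 1 := by omega
  have hMo : Odd M := by rw [hM]; exact hLodd.pow
  have hsodd : Odd (L ^ k) := hLodd.pow
  obtain ⟨t, ht⟩ : ∃ t, N = k + t := ⟨N - k, by omega⟩
  have hMt : M = L ^ k * L ^ t := by rw [← pow_add, ← ht]; exact hM
  have htodd : Odd (L ^ t) := hLodd.pow
  -- restrict `K` to connected `k`-polymers
  set K' : Finset (Fin d → ZMod M) → ((Fin d → ZMod M) → ℝ) → ℂ :=
    fun X => if IsPolymer (L ^ k) X ∧ IsConn X then K X else 0 with hK'def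
  have hK'eq : ∀ X, IsPolymer (L ^ k) X → IsConn X → K' X = K X := fun X hX hc => by
    show (if IsPolymer (L ^ k) X ∧ IsConn X then K X else 0) = K X
    exact if_pos ⟨hX, hc⟩
  have hK'ne : ∀ X, ¬ (IsPolymer (L ^ k) X ∧ IsConn X) → K' X = 0 := fun X hX => by
    show (if IsPolymer (L ^ k) X ∧ IsConn X then K X else 0) = 0
    exact if_neg hX
  have hK' : WeakNormLE P k K' C := fun X hX hc => by rw [hK'eq X hX hc]; exact hK X hX hc
  have hK'd : ∀ X, ContDiff ℝ P.r₀ (K' X) := fun X => by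
    by_cases hX : IsPolymer (L ^ k) X ∧ IsConn X
    · rw [hK'eq X hX.1 hX.2]; exact hKd X
    · rw [hK'ne X hX]; exact contDiff_const
  have hK'loc : ∀ X, IsPolymer (P.L ^ k) X → IsConn X → IsGaugeLocal (P.gauge k X) (K' X) :=
    fun X hX hc => by rw [hK'eq X hX hc]; exact hKloc X hX hc
  have hR'd : ∀ X, ContDiff ℝ P.r₀ (fluct (𝒞 (k + 1)) (K' X)) := fun X => by
    by_cases hX : IsPolymer (L ^ k) X ∧ IsConn X
    · rw [hK'eq X hX.1 hX.2]
      exact contDiff_fluct_of_weakNormLE hθbar hlam hB hk1 hA0 hC hK hKd hKloc hX.1 hX.2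
    · rw [hK'ne X hX]
      have h0 : fluct (𝒞 (k + 1)) (0 : ((Fin d → ZMod M) → ℝ) → ℂ) = fun _ => 0 := fluct_const _ 0
      rw [h0]; exact contDiff_const
  have hK't : TransInv (L ^ k) K' := by
    intro a ha X φ
    by_cases hX : IsPolymer (L ^ k) X ∧ IsConn X
    · have hX' : IsPolymer (L ^ k) (translate a X) ∧ IsConn (translate a X) :=
        ⟨isPolymer_translate hMt hsodd htodd ha hX.1, isConn_translate hX.2 a⟩
      rw [hK'eq _ hX'.1 hX'.2, hK'eq X hX.1 hX.2]
      exact hKt a ha X φ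
    · have hX' : ¬ (IsPolymer (L ^ k) (translate a X) ∧ IsConn (translate a X)) := by
        intro h'
        apply hX
        have e : translate (-a) (translate a X) = X := by rw [translate_translate, add_neg_cancel, translate_zero]
        exact ⟨e ▸ isPolymer_translate hMt hsodd htodd ha.neg h'.1, e ▸ isConn_translate h'.2 (-a)⟩
      rw [hK'ne _ hX', hK'ne X hX]
      rfl
  -- the linearised map only reads `K` on connected polymers
  have hB₀c : IsPolymer (L ^ k) D.B₀ ∧ IsConn D.B₀ := by
    rw [hB₀]; exact ⟨isPolymer_blockOf _ x₀, TorusPolymer.isConn_blockOf hMo hsodd x₀⟩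
  have hopB : opB D K' = opB D K := by
    unfold opB; rw [hK'eq D.B₀ hB₀c.1 hB₀c.2]
  have hopC : opC D K = opC D K' := by
    funext U φ
    show blockPart D K U φ + largePart D.s D.L (fluct D.𝒞) K U φ =
      blockPart D K' U φ + largePart D.s D.L (fluct D.𝒞) K' U φ
    congr 1
    · unfold blockPart
      refine sum_congr rfl fun B hB' => ?_
      have hBb := blockPartIndex_subset_blocks D U hB'
      rw [hDs] at hBb
      obtain ⟨y, -, rfl⟩ := mem_blocks.1 hBb
      unfold blockTerm
      rw [hopB, hK'eq _ (isPolymer_blockOf _ y) (TorusPolymer.isConn_blockOf hMo hsodd y)]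
    · unfold largePart
      rw [hDs, hDL]
      refine sum_congr rfl fun X hX => ?_
      obtain ⟨hXp, hXc, -, -⟩ := mem_largePartIndex.1 hX
      rw [hK'eq X hXp hXc]
  rw [hopC]
  exact weakNormLE_opC_abkm_gain hd hLodd hL hM hkN hp hpM hMR hr₀ hθbar hlam hB hδ₀ hδ₁ hh hh0 hA𝒫 hA hA𝒫A hsmall
    D hDs hDL hD𝒞 hB₀ hc₀ hC hK' hK't hK'd hK'loc hR'd

/-- **The large part is `C^{r₀}`** for the torus data (its index set consists of connected polymers).
[cite: AdamsBuchholzKoteckyMuller2019, Lemma 10.2 / Lemma 8.4] -/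
theorem contDiff_largePart_abkm {L N Mord R n p r₀ : ℕ} {θbar lam μ δ₁ δ₀ A𝒫 h A : ℝ}
    {𝒞 : ℕ → (Fin d → ZMod M) → ℝ} (hθbar : 0 < θbar) (hlam : 0 < lam)
    (hB : AbkmWeightBounds L N Mord R n θbar lam μ δ₁ δ₀ A𝒫 𝒞
      (abkmWeightData L N Mord R θbar (schedDelta δ₀ δ₁ N) 𝒞))
    {k : ℕ} (hk : k + 1 ≤ N + 1) (hA : 0 < A)
    {K : Finset (Fin d → ZMod M) → ((Fin d → ZMod M) → ℝ) → ℂ} {C : ℝ} (hC : 0 ≤ C)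
    (hK : WeakNormLE (abkmNormParams L N Mord R p r₀ h θbar A (schedDelta δ₀ δ₁ N) 𝒞) k K C)
    (hKd : ∀ X, ContDiff ℝ r₀ (K X))
    (hKloc : ∀ X, IsPolymer (L ^ k) X → IsConn X →
      IsGaugeLocal ((abkmNormParams L N Mord R p r₀ h θbar A (schedDelta δ₀ δ₁ N) 𝒞).gauge k X) (K X))
    (U : Finset (Fin d → ZMod M)) :
    ContDiff ℝ r₀ (largePart (L ^ k) L (fluct (𝒞 (k + 1))) K U) := by
  have hfun : largePart (L ^ k) L (fluct (𝒞 (k + 1))) K U =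
      fun φ => ∑ X ∈ largePartIndex (L ^ k) L U, fluct (𝒞 (k + 1)) (K X) φ := by
    funext φ; rfl
  rw [hfun]
  refine ContDiff.sum fun X hX => ?_
  obtain ⟨hXp, hXc, -, -⟩ := mem_largePartIndex.1 hX
  exact contDiff_fluct_of_weakNormLE hθbar hlam hB hk hA hC hK hKd hKloc hXp hXc

/-- **`blockPart` is additive in `K`** (difference form, torus data):
`blockPart D K U − blockPart D K' U = blockPart D (K − K') U`.
[cite: AdamsBuchholzKoteckyMuller2019, Theorem 6.8 (C_k is linear) / Ch. 10.1 (10.3)] -/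
theorem blockPart_sub_abkm {L N Mord R n p r₀ : ℕ} {θbar lam μ δ₁ δ₀ A𝒫 h A : ℝ}
    {𝒞 : ℕ → (Fin d → ZMod M) → ℝ} (hθbar : 0 < θbar) (hlam : 0 < lam)
    (hB : AbkmWeightBounds L N Mord R n θbar lam μ δ₁ δ₀ A𝒫 𝒞
      (abkmWeightData L N Mord R θbar (schedDelta δ₀ δ₁ N) 𝒞))
    {k : ℕ} (hk : k + 1 ≤ N + 1) (hr₀ : 2 ≤ r₀) (hLodd : Odd L) (hM : M = L ^ N) (hA : 0 < A)
    (D : StepData d M) (hDs : D.s = L ^ k) (hD𝒞 : D.𝒞 = 𝒞 (k + 1)) {x₀ : Fin d → ZMod M}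
    (hB₀ : D.B₀ = blockOf (L ^ k) x₀)
    {K K' : Finset (Fin d → ZMod M) → ((Fin d → ZMod M) → ℝ) → ℂ} {C C' : ℝ} (hC : 0 ≤ C) (hC' : 0 ≤ C')
    (hK : WeakNormLE (abkmNormParams L N Mord R p r₀ h θbar A (schedDelta δ₀ δ₁ N) 𝒞) k K C)
    (hK' : WeakNormLE (abkmNormParams L N Mord R p r₀ h θbar A (schedDelta δ₀ δ₁ N) 𝒞) k K' C')
    (hKd : ∀ X, ContDiff ℝ r₀ (K X)) (hK'd : ∀ X, ContDiff ℝ r₀ (K' X))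
    (hKloc : ∀ X, IsPolymer (L ^ k) X → IsConn X →
      IsGaugeLocal ((abkmNormParams L N Mord R p r₀ h θbar A (schedDelta δ₀ δ₁ N) 𝒞).gauge k X) (K X))
    (hK'loc : ∀ X, IsPolymer (L ^ k) X → IsConn X →
      IsGaugeLocal ((abkmNormParams L N Mord R p r₀ h θbar A (schedDelta δ₀ δ₁ N) 𝒞).gauge k X) (K' X))
    (U : Finset (Fin d → ZMod M)) :
    (fun φ => blockPart D K U φ - blockPart D K' U φ) = blockPart D (K - K') U := by
  funext φ
  show (∑ B ∈ blockPartIndex D U, blockTerm D K B φ) - ∑ B ∈ blockPartIndex D U, blockTerm D K' B φ =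
    ∑ B ∈ blockPartIndex D U, blockTerm D (K - K') B φ
  rw [← sum_sub_distrib]
  refine sum_congr rfl fun B hB' => ?_
  have hBb := blockPartIndex_subset_blocks D U hB'
  rw [hDs] at hBb
  obtain ⟨y, -, rfl⟩ := mem_blocks.1 hBb
  have h := blockTerm_sub_abkm hθbar hlam hB hk hr₀ hLodd hM hA D hD𝒞 hB₀ y hC hC' hK hK' hKd hK'd hKloc hK'loc
  exact congrFun h φ

/-- **The block part of `C_kK` on a connected `(k+1)`-polymer** ([ABKM19] Lemma 10.1 + Lemma 10.2,
`blockPart = opC − largePart`): with the data of `weakNormLE_opC_abkm_conn`,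
`|blockPart D K U|_{T_{k+1}^{U*}, w_{k+1}^U} ≤ C(θ₀ + ε)A^{−|U|_{k+1}}`.
[cite: AdamsBuchholzKoteckyMuller2019, Lemma 10.1 / Lemma 10.2] -/
theorem tayNormLE_blockPart_abkm {L N Mord R n p r₀ : ℕ} {θbar lam μ δ₁ δ₀ A𝒫 h A : ℝ}
    {𝒞 : ℕ → (Fin d → ZMod M) → ℝ} (hd : 3 ≤ d) (hLodd : Odd L) (hL : 2 ^ (d + 3) + 16 * R ≤ L)
    (hM : M = L ^ N) {k : ℕ} (hkN : k + 1 ≤ N) (hp : d / 2 + 2 ≤ p) (hpM : p + d ≤ Mord)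
    (hMR : Mord ≤ R) (hr₀ : 3 ≤ r₀) (hθbar : 0 < θbar) (hlam : 0 < lam)
    (hB : AbkmWeightBounds L N Mord R n θbar lam μ δ₁ δ₀ A𝒫 𝒞
      (abkmWeightData L N Mord R θbar (schedDelta δ₀ δ₁ N) 𝒞))
    (hδ₀ : 0 < δ₀) (hδ₁ : 0 < δ₁) (hh : 0 < h) (hh0 : hZeroSq d R δ₀ δ₁ ≤ h ^ 2)
    (hA𝒫 : 0 ≤ A𝒫) (hA : 1 ≤ A) (hA𝒫A : A𝒫 ≤ A)
    (hsmall : (2 : ℝ) ^ (L ^ d) * (A𝒫 * A ^ (-(1 - (1 + 1 / ((2 * (2 ^ d + 1) + 6 : ℝ) ^ d))⁻¹) : ℝ)) ≤ 1)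
    (D : StepData d M) (hDs : D.s = L ^ k) (hDL : D.L = L) (hD𝒞 : D.𝒞 = 𝒞 (k + 1))
    {x₀ : Fin d → ZMod M} (hB₀ : D.B₀ = blockOf (L ^ k) x₀)
    (hc₀ : D.c₀ = boxCorner (L ^ k) (starRad R L d k) x₀)
    {K : Finset (Fin d → ZMod M) → ((Fin d → ZMod M) → ℝ) → ℂ} {C : ℝ} (hC : 0 ≤ C)
    (hK : WeakNormLE (abkmNormParams L N Mord R p r₀ h θbar A (schedDelta δ₀ δ₁ N) 𝒞) k K C)
    (hKt : TransInv (L ^ k) K) (hKd : ∀ X, ContDiff ℝ r₀ (K X))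
    (hKloc : ∀ X, IsPolymer (L ^ k) X → IsConn X →
      IsGaugeLocal ((abkmNormParams L N Mord R p r₀ h θbar A (schedDelta δ₀ δ₁ N) 𝒞).gauge k X) (K X))
    {U : Finset (Fin d → ZMod M)} (hU : IsPolymer (L ^ (k + 1)) U) (hUc : IsConn U) :
    TayNormLE ((abkmNormParams L N Mord R p r₀ h θbar A (schedDelta δ₀ δ₁ N) 𝒞).gauge (k + 1) U) r₀
      ((abkmWeightData L N Mord R θbar (schedDelta δ₀ δ₁ N) 𝒞).weight (k + 1) U) (blockPart D K U)
      (C * ((L : ℝ) ^ d * (A𝒫 * abkmContrConst d L R) +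
          largePartEps d L A A𝒫 (1 + 1 / ((2 * (2 ^ d + 1) + 6 : ℝ) ^ d)) +
          largePartEps d L A A𝒫 (1 + 1 / ((2 * (2 ^ d + 1) + 6 : ℝ) ^ d))) *
        (abkmNormParams L N Mord R p r₀ h θbar A (schedDelta δ₀ δ₁ N) 𝒞).aFactor (k + 1) U) := by
  set P := abkmNormParams L N Mord R p r₀ h θbar A (schedDelta δ₀ δ₁ N) 𝒞 with hP
  set W := abkmWeightData L N Mord R θbar (schedDelta δ₀ δ₁ N) 𝒞 with hW
  have hA0 : 0 < A := by linarith
  have hk1 : k + 1 ≤ N + 1 := by omega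
  have h1 := weakNormLE_opC_abkm_conn hd hLodd hL hM hkN hp hpM hMR hr₀ hθbar hlam hB hδ₀ hδ₁ hh hh0 hA𝒫 hA hA𝒫A
    hsmall D hDs hDL hD𝒞 hB₀ hc₀ hC hK hKt hKd hKloc U hU hUc
  have h2 := tayNormLE_largePart_fluct_abkm (p := p) (r₀ := r₀) hd hLodd hL hM hkN hθbar hlam hB hh hA𝒫 hA hA𝒫A
    hsmall hC hK hKd hKloc hU hUc.1
  have hbd := contDiff_blockPart_abkm hθbar hlam hB hLodd hM hk1 hA0 D hDs hD𝒞 hC hK hKd hKloc U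
  have hld := contDiff_largePart_abkm (p := p) (r₀ := r₀) hθbar hlam hB hk1 hA0 hC hK hKd hKloc U
  have hopCd : ContDiff ℝ r₀ (opC D K U) := by
    have : opC D K U = fun φ => blockPart D K U φ + largePart D.s D.L (fluct D.𝒞) K U φ := by funext φ; rfl
    rw [this, hDs, hDL, hD𝒞]
    exact hbd.add hld
  have heq : blockPart D K U = opC D K U + (-1 : ℝ) • largePart (L ^ k) L (fluct (𝒞 (k + 1))) K U := by
    funext φ
    show blockPart D K U φ = (blockPart D K U φ + largePart D.s D.L (fluct D.𝒞) K U φ) +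
      (-1 : ℝ) • largePart (L ^ k) L (fluct (𝒞 (k + 1))) K U φ
    rw [hDs, hDL, hD𝒞, neg_one_smul]
    ring
  rw [heq]
  refine ((h1.add (h2.smul hld (-1)) hopCd (hld.const_smul (-1 : ℝ))).mono (le_of_eq ?_)
    fun φ => (W.weight_pos (k + 1) U φ).le)
  rw [abs_neg, abs_one, one_mul]
  show C * ((L : ℝ) ^ d * (A𝒫 * abkmContrConst d L R) +
      largePartEps d L A A𝒫 (1 + 1 / ((2 * (2 ^ d + 1) + 6 : ℝ) ^ d))) * P.aFactor (k + 1) U +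
    C * largePartEps d L A A𝒫 (1 + 1 / ((2 * (2 ^ d + 1) + 6 : ℝ) ^ d)) * P.aFactor (k + 1) U = _
  ring

/-- **Lipschitz (= linear) bound of the block part**: with the data of `tayNormLE_blockPart_abkm` for `K`
and `K'` (`‖K‖ ≤ C`, `‖K'‖ ≤ C'`) and `‖K − K'‖_k^{(A)} ≤ C_Δ`, on a connected `(k+1)`-polymer `U`:
`|blockPart D K U − blockPart D K' U|_{T_{k+1}^{U*}, w_{k+1}^U} ≤ C_Δ(θ₀ + ε)A^{−|U|_{k+1}}`.
[cite: AdamsBuchholzKoteckyMuller2019, Lemma 10.1 / Lemma 10.2] -/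
theorem tayNormLE_blockPart_sub_abkm {L N Mord R n p r₀ : ℕ} {θbar lam μ δ₁ δ₀ A𝒫 h A : ℝ}
    {𝒞 : ℕ → (Fin d → ZMod M) → ℝ} (hd : 3 ≤ d) (hLodd : Odd L) (hL : 2 ^ (d + 3) + 16 * R ≤ L)
    (hM : M = L ^ N) {k : ℕ} (hkN : k + 1 ≤ N) (hp : d / 2 + 2 ≤ p) (hpM : p + d ≤ Mord)
    (hMR : Mord ≤ R) (hr₀ : 3 ≤ r₀) (hθbar : 0 < θbar) (hlam : 0 < lam)
    (hB : AbkmWeightBounds L N Mord R n θbar lam μ δ₁ δ₀ A𝒫 𝒞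
      (abkmWeightData L N Mord R θbar (schedDelta δ₀ δ₁ N) 𝒞))
    (hδ₀ : 0 < δ₀) (hδ₁ : 0 < δ₁) (hh : 0 < h) (hh0 : hZeroSq d R δ₀ δ₁ ≤ h ^ 2)
    (hA𝒫 : 0 ≤ A𝒫) (hA : 1 ≤ A) (hA𝒫A : A𝒫 ≤ A)
    (hsmall : (2 : ℝ) ^ (L ^ d) * (A𝒫 * A ^ (-(1 - (1 + 1 / ((2 * (2 ^ d + 1) + 6 : ℝ) ^ d))⁻¹) : ℝ)) ≤ 1)
    (D : StepData d M) (hDs : D.s = L ^ k) (hDL : D.L = L) (hD𝒞 : D.𝒞 = 𝒞 (k + 1))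
    {x₀ : Fin d → ZMod M} (hB₀ : D.B₀ = blockOf (L ^ k) x₀)
    (hc₀ : D.c₀ = boxCorner (L ^ k) (starRad R L d k) x₀)
    {K K' : Finset (Fin d → ZMod M) → ((Fin d → ZMod M) → ℝ) → ℂ} {C C' CΔ : ℝ} (hC : 0 ≤ C) (hC' : 0 ≤ C')
    (hCΔ : 0 ≤ CΔ)
    (hK : WeakNormLE (abkmNormParams L N Mord R p r₀ h θbar A (schedDelta δ₀ δ₁ N) 𝒞) k K C)
    (hK' : WeakNormLE (abkmNormParams L N Mord R p r₀ h θbar A (schedDelta δ₀ δ₁ N) 𝒞) k K' C')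
    (hΔ : WeakNormLE (abkmNormParams L N Mord R p r₀ h θbar A (schedDelta δ₀ δ₁ N) 𝒞) k (K - K') CΔ)
    (hKt : TransInv (L ^ k) K) (hK't : TransInv (L ^ k) K')
    (hKd : ∀ X, ContDiff ℝ r₀ (K X)) (hK'd : ∀ X, ContDiff ℝ r₀ (K' X))
    (hKloc : ∀ X, IsPolymer (L ^ k) X → IsConn X →
      IsGaugeLocal ((abkmNormParams L N Mord R p r₀ h θbar A (schedDelta δ₀ δ₁ N) 𝒞).gauge k X) (K X))
    (hK'loc : ∀ X, IsPolymer (L ^ k) X → IsConn X →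
      IsGaugeLocal ((abkmNormParams L N Mord R p r₀ h θbar A (schedDelta δ₀ δ₁ N) 𝒞).gauge k X) (K' X))
    {U : Finset (Fin d → ZMod M)} (hU : IsPolymer (L ^ (k + 1)) U) (hUc : IsConn U) :
    TayNormLE ((abkmNormParams L N Mord R p r₀ h θbar A (schedDelta δ₀ δ₁ N) 𝒞).gauge (k + 1) U) r₀
      ((abkmWeightData L N Mord R θbar (schedDelta δ₀ δ₁ N) 𝒞).weight (k + 1) U)
      (fun φ => blockPart D K U φ - blockPart D K' U φ)
      (CΔ * ((L : ℝ) ^ d * (A𝒫 * abkmContrConst d L R) +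
          largePartEps d L A A𝒫 (1 + 1 / ((2 * (2 ^ d + 1) + 6 : ℝ) ^ d)) +
          largePartEps d L A A𝒫 (1 + 1 / ((2 * (2 ^ d + 1) + 6 : ℝ) ^ d))) *
        (abkmNormParams L N Mord R p r₀ h θbar A (schedDelta δ₀ δ₁ N) 𝒞).aFactor (k + 1) U) := by
  have hA0 : 0 < A := by linarith
  have hk1 : k + 1 ≤ N + 1 := by omega
  have hr₀2 : 2 ≤ r₀ := by omega
  have hKΔd : ∀ X, ContDiff ℝ r₀ ((K - K') X) := fun X => by
    show ContDiff ℝ r₀ (K X - K' X); exact (hKd X).sub (hK'd X)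
  have hKΔloc : ∀ X, IsPolymer (L ^ k) X → IsConn X →
      IsGaugeLocal ((abkmNormParams L N Mord R p r₀ h θbar A (schedDelta δ₀ δ₁ N) 𝒞).gauge k X) ((K - K') X) :=
    fun X hX hc φ ψ e => by
      show (K X - K' X) φ = (K X - K' X) ψ
      simp only [Pi.sub_apply]
      rw [hKloc X hX hc φ ψ e, hK'loc X hX hc φ ψ e]
  have hKΔt : TransInv (L ^ k) (K - K') := fun a ha X φ => by
    show K _ _ - K' _ _ = K X φ - K' X φ
    rw [hKt a ha X φ, hK't a ha X φ]
  rw [blockPart_sub_abkm hθbar hlam hB hk1 hr₀2 hLodd hM hA0 D hDs hD𝒞 hB₀ hC hC' hK hK' hKd hK'd hKloc hK'loc U]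
  exact tayNormLE_blockPart_abkm hd hLodd hL hM hkN hp hpM hMR hr₀ hθbar hlam hB hδ₀ hδ₁ hh hh0 hA𝒫 hA hA𝒫A hsmall
    D hDs hDL hD𝒞 hB₀ hc₀ hCΔ hΔ hKΔt hKΔd hKΔloc hU hUc

end Literature.MathematicalPhysics.StatisticalMechanics.GradientRG

end
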